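import Summits.QuantumFields.YangMills.Theorems.BalabanUVNodesN13UV01LevelZeroGibbsNormalised
import Summits.QuantumFields.YangMills.Theorems.BalabanUVNodesK1R9SlotOfAESuccNormalisationLettersAtRecord

/-!
# BalabanUVNodes ∕ K1⁹ — THE (B)-SLOT AND THE DECIDING CRUX BY NAME FROM THE GIBBS ROAD: «Theorem 1 + GIBBS NORMALISATION (`E(P) = log Z_{T^{(0)}}(g₀⁻²)`) + (2.50) a.e. above
# level 0 + the rows» — NO normalisation item, NO coupling floor; the level-0 exponent as a function of the coupling alone

Cell `pub-ymgap` (D-0062 Track A ∕ D-0149 width), WIDTH SEAT `pub-ymgap-dag-n13-w1` (gen 6, CLAIM-9), key K1⁹ `StabilityBRunRowsAtRecordR13SepCoPHV` = stmt-QuantumFields-27364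
(`route-QuantumFields-BalabanUVNodes` rev 29; `--kind proof --supports … --as helper`; count-neutral).  OWN LINEAGE: p645546 (v1.1) `…N13UV01LevelZeroGibbsNormalised` (the Gibbs level-0
face, every run incl. `K = 0`), p640011 `…K1R9SlotOfAESuccNormalisationLettersAtRecord` (the letter-keyed template), g5's p622796 (the route-free slot junction).

THE POINT.  Of the three N13 level-0 roads this lineage typed — reader's-item letters (p638515 ∕ p640011), print's `z` (p643638 ∕ p644747), Gibbs normalisation (p645546 ∕ p646355) — the
Gibbs road has the FEWEST hypotheses: no z∕Efl item and no coupling floor (so K1⁹'s row (iv) is not consumed at level 0).  §1 makes its upper exponent a function of the coupling ALONE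
(`ep_Z(g₀) ≤ ep♯_Z(g₀) := 4(d(𝔤)·log g₀⁻¹ + C_N) + 128`, using `3 + 1∕n₀ ≤ 4`; [III] Cor. 3's «depending on g_k» forbids reading the run) and states the level-0 face in [B16]'s carrier at
the record datum for EVERY γ-windowed run (`K = 0`: `E = 0`; `K ≥ 1`: `E = log Z`).  §2 (`N = 2`): the K1⁹ (B)-slot from Thm 1's clause + Gibbs normalisation on γ-windowed runs with
`K ≥ 1` + (2.50) `dV_{k+1}`-a.e. at levels `≥ 1` (p622796 junction, exponent pairs merged by `max`), and K1⁹ BY NAME from that road + `RunRowsCont13` (used only for the window conjunct).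

CONTENTS.  §1 `gibbsConst_nonneg` (`C_N ≥ 0`), `gibbsExp_le_sharp`, ★ `uvIneq_zero_datumOfRecord₁₃CoPH_of_gibbs`.  §2 ★★ `exists_revision₁₃_endStatementBPrinted_of_aeSucc_of_gibbs`, ★★★
`stabilityBRunRowsAtRecordR13SepCoPHV_of_aeSuccRoad_rows_of_gibbs`.

HONEST FRAMING.  By-name composition; CONDITIONAL on the displayed hypotheses — (2.50) a.e. at levels ≥ 1 remains THE open analytic entry of the (B)-face; the Gibbs normalisation is a
legal value of an OPEN letter (p645546 §3 exhibits it in DEF-1's Z family), NOT Bałaban's `E_k`; K1⁹ NEITHER proved NOR refuted; N13 NOT discharged; no stub closed; counts unmoved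
(typed 28∕28 · discharged 5∕27 · A 5∕28); one finite `𝕋⁴_{L^K}` programme at fixed ε; R4 closes the CONDITIONAL finite-𝕋⁴ rung `BalabanLadder.UV` only — the Yang–Mills mass gap
(Clay) is NOT proved by any of this.  No `sorry`, `def`, `instance`, `notation`; standard axioms.
-/

noncomputable section

open scoped BigOperators

namespace Summit.QuantumFields.YangMills.BalabanUVNodes.K1R9SlotOfAESuccGibbsAtRecord

open MeasureTheory
open Literature.MathematicalPhysics.QuantumFieldTheory.Balaban1983to89
open Literature.MathematicalPhysics.QuantumFieldTheory.Balaban1983to89.T4Continuum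
open Literature.MathematicalPhysics.QuantumFieldTheory.Balaban1983to89.Node00
open Literature.MathematicalPhysics.QuantumFieldTheory.Balaban1983to89.FlowStepRuns (genFlow genSeq genSeq_zero)
open Literature.MathematicalPhysics.QuantumFieldTheory.Balaban1983to89.Missing
open Literature.MathematicalPhysics.QuantumFieldTheory.Balaban1983to89.T4DatumAssembly.TowerReviseAE (uvIneq_mono_upper)
open Summit.QuantumFields.YangMills.BalabanUVNodes.K1R9VersionSlotOfAEAtRecord (exists_revision₁₃_endStatementBPrinted_of_ae)
open Summit.QuantumFields.YangMills.BalabanUVNodes.K1R9SlotOfAESuccLevelZeroAtRecord (uvIneq_mono_lower chi_datumOfRecord₁₃SepCoPH_nonneg)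
open Summit.QuantumFields.YangMills.BalabanUVNodes.N13UV01LevelZeroGibbsNormalised (uv_zero_densOfRecord₁₃_of_gibbs uv_zero_densOfRecord₁₃_of_K_zero)
open Summit.QuantumFields.YangMills.Theorems.K1V6Defs (Inhabited13)
open Summit.QuantumFields.YangMills.Theorems.BalabanUVNodesK1R8RowsDefs (RunRowsCont13)
open Summit.QuantumFields.YangMills.Theorems.BalabanUVNodesK1R9WindowConjunctIdle (stabilityBRunRowsAtRecordR13SepCoPHV_of_windowFree)
open Summit.QuantumFields.YangMills.Theses.BalabanUVNodes (StabilityBRunRowsAtRecordR13SepCoPHV)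

variable {F : T4Family} {N : ℕ} [NeZero N]

/-! ## §1 The Gibbs level-0 exponent as a function of `g₀` ALONE, and the level-0 face in [B16]'s carrier at the record datum (every run) -/

/-- `C_N := N²·log(16π+1) + log((2N+1)∕(4π)) ≥ 0` (`≥ log(12 + 3∕(4π))`). [folklore] -/
theorem gibbsConst_nonneg : 0 ≤ ((N * N : ℕ) : ℝ) * Real.log (16 * Real.pi + 1) + Real.log ((2 * N + 1) / (4 * Real.pi)) := by
  have hN1 : (1 : ℝ) ≤ N := by exact_mod_cast Nat.pos_of_ne_zero (NeZero.ne N)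
  have hNN : (1 : ℝ) ≤ ((N * N : ℕ) : ℝ) := by push_cast; nlinarith
  have hπ := Real.pi_pos
  have hπ3 := Real.pi_gt_three
  have h1 : 0 ≤ Real.log (16 * Real.pi + 1) := Real.log_nonneg (by linarith)
  have hA : Real.log (16 * Real.pi + 1) ≤ ((N * N : ℕ) : ℝ) * Real.log (16 * Real.pi + 1) := le_mul_of_one_le_left h1 hNN
  have hB : Real.log (3 / (4 * Real.pi)) ≤ Real.log ((2 * N + 1) / (4 * Real.pi)) :=
    Real.log_le_log (by positivity) (div_le_div_of_nonneg_right (by linarith) (by positivity))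
  have hprod : (1 : ℝ) ≤ (16 * Real.pi + 1) * (3 / (4 * Real.pi)) := by
    rw [← mul_div_assoc, le_div_iff₀ (by positivity)]; nlinarith
  have hsum : 0 ≤ Real.log (16 * Real.pi + 1) + Real.log (3 / (4 * Real.pi)) := by
    rw [← Real.log_mul (by positivity) (by positivity)]; exact Real.log_nonneg hprod
  linarith

/-- **THE GIBBS EXPONENT AS A FUNCTION OF THE COUPLING ALONE**: `ep_Z(g) ≤ ep^♯_Z(g) := 4·(d(𝔤)·log g⁻¹ + C_N) + 128` (`3 + 1∕n₀ ≤ 4`), and `0 ≤ ep^♯_Z(g)` for `0 < g ≤ 1` — the Cor.-3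
dependence functions must not read the run. [cite: Balaban1988Convergent, Cor. 3 (2.50) p.264 «depending on g_k»] -/
theorem gibbsExp_le_sharp (K : ℕ) {g : ℝ} (hg : 0 < g) (hg1 : g ≤ 1) :
    (3 + ((F.P K).sitesPerDir 0 : ℝ)⁻¹) * (((dimSU N : ℕ) : ℝ) * Real.log g⁻¹ + (((N * N : ℕ) : ℝ) * Real.log (16 * Real.pi + 1) + Real.log ((2 * N + 1) / (4 * Real.pi)))) + 128 ≤
      4 * (((dimSU N : ℕ) : ℝ) * Real.log g⁻¹ + (((N * N : ℕ) : ℝ) * Real.log (16 * Real.pi + 1) + Real.log ((2 * N + 1) / (4 * Real.pi)))) + 128 := by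
  have hlog : 0 ≤ Real.log g⁻¹ := Real.log_nonneg ((one_le_inv₀ hg).mpr hg1)
  have hC := gibbsConst_nonneg (N := N)
  have hX : 0 ≤ ((dimSU N : ℕ) : ℝ) * Real.log g⁻¹ + (((N * N : ℕ) : ℝ) * Real.log (16 * Real.pi + 1) + Real.log ((2 * N + 1) / (4 * Real.pi))) :=
    add_nonneg (mul_nonneg (Nat.cast_nonneg _) hlog) hC
  have hn : ((F.P K).sitesPerDir 0 : ℝ)⁻¹ ≤ 1 := by
    have h1 : (1 : ℝ) ≤ ((F.P K).sitesPerDir 0 : ℝ) := by exact_mod_cast Nat.one_le_iff_ne_zero.mpr ((F.P K).sitesPerDir_ne_zero 0)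
    exact inv_le_one_of_one_le₀ h1
  nlinarith

/-- ★ **(2.50) AT LEVEL `0` IN [B16]'s CARRIER AT THE RECORD DATUM, EVERY γ-WINDOWED RUN (`γ ≤ 1`), AT A GIBBS-NORMALISED PARAMETER** (`E(P) = log Z` whenever `K ≥ 1`; for `K = 0`, `E(P) = 0`):
`B16.UVIneq ((datumOfRecord₁₃CoPH F N θ h).C P) 0 V (12g₀⁻²) (ep^♯_Z(g₀))`. [cite: Balaban1989LargeFieldII, (0.1) pp.355–356; Balaban1988Convergent, Cor. 3 (2.50) p.264] -/
theorem uvIneq_zero_datumOfRecord₁₃CoPH_of_gibbs (θ : Stage13HParams F N) (h : θ.Provisos₁₃CoPH F N) (P : B12.RunParams) {γ : ℝ} (hγ : γ ≤ 1)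
    (hI : (genFlow (betaOfRecord₁₃ F N θ.toStage13Params) P.g0).InInterval γ P.K)
    (hE : 1 ≤ P.K → EOfRecord₁₃ F N θ.toStage13Params P = Real.log (partitionFn (G := SU N) (F.P P.K) (P.g0⁻¹ ^ 2)))
    (V : GaugeField (F.P P.K) 0 (SU N)) :
    B16.UVIneq ((datumOfRecord₁₃CoPH F N θ h).C P) 0 V (0 + 12 * (1 / gOfRecord₁₃ F N θ.toStage13Params P 0) ^ 2)
      (4 * (((dimSU N : ℕ) : ℝ) * Real.log (gOfRecord₁₃ F N θ.toStage13Params P 0)⁻¹ + (((N * N : ℕ) : ℝ) * Real.log (16 * Real.pi + 1) + Real.log ((2 * N + 1) / (4 * Real.pi)))) + 128) := by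
  have hg := hI 0 (Nat.zero_le _)
  have hsharp := gibbsExp_le_sharp (F := F) (N := N) P.K hg.1 (hg.2.trans hγ)
  have hcard : 0 ≤ (Fintype.card (Site (F.P P.K) 0) : ℝ) := Nat.cast_nonneg _
  rcases Nat.eq_zero_or_pos P.K with hK | hK
  · have hlog : 0 ≤ Real.log (gOfRecord₁₃ F N θ.toStage13Params P 0)⁻¹ := Real.log_nonneg ((one_le_inv₀ hg.1).mpr (hg.2.trans hγ))
    have hep : 0 ≤ 4 * (((dimSU N : ℕ) : ℝ) * Real.log (gOfRecord₁₃ F N θ.toStage13Params P 0)⁻¹ +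
        (((N * N : ℕ) : ℝ) * Real.log (16 * Real.pi + 1) + Real.log ((2 * N + 1) / (4 * Real.pi)))) + 128 :=
      add_nonneg (mul_nonneg (by norm_num) (add_nonneg (mul_nonneg (Nat.cast_nonneg _) hlog) gibbsConst_nonneg)) (by norm_num)
    have h0 := uv_zero_densOfRecord₁₃_of_K_zero θ.toStage13Params P hK hep V
    refine (B16NodeKnitRecord13CoPH.uvIneq_at_record₁₃CoPH_iff F N θ h P 0 V _ _).mpr ⟨?_, h0.2⟩
    convert h0.1 using 3
    ring
  · have h0 := uv_zero_densOfRecord₁₃_of_gibbs θ.toStage13Params P hγ hI (hE hK) V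
    refine (B16NodeKnitRecord13CoPH.uvIneq_at_record₁₃CoPH_iff F N θ h P 0 V _ _).mpr ⟨?_, ?_⟩
    · convert h0.1 using 3
      ring
    · exact h0.2.trans (Real.exp_le_exp.mpr (mul_le_mul_of_nonneg_right hsharp hcard))

/-! ## §2 (`N = 2`) The K1⁹ (B)-slot and the deciding crux BY NAME from the GIBBS road: NO normalisation item, NO coupling floor -/

/-- ★★ **THE K1⁹ (B)-SLOT FROM THEOREM 1's CLAUSE + GIBBS NORMALISATION ON γ-WINDOWED RUNS + (2.50) `dV_{k+1}`-A.E. AT LEVELS `k+1 ≤ K`** (`0 < γ ≤ 1`): level `0` at EVERY field by §1,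
exponent pairs merged by `max`, then the route-free junction `exists_revision₁₃_endStatementBPrinted_of_ae` (p622796).  The weakest N13-side hypothesis set typed so far for the slot.
[cite: Balaban1989LargeFieldII, Thm 1 + (0.1) pp.355–356; Balaban1988Convergent, (2.18) p.257, Cor. 3 (2.50) p.264, Thm 1 p.262] -/
theorem exists_revision₁₃_endStatementBPrinted_of_aeSucc_of_gibbs {F : T4Family} (θ : Stage13HParams F 2) (h : θ.Provisos₁₃SepCoPH F 2) {γ : ℝ} (hγ : 0 < γ) (hγ1 : γ ≤ 1)
    (hE : ∀ p : B12.RunParams, ((datumOfRecord₁₃SepCoPH F 2 θ h).C p).flow.InInterval γ p.K → 1 ≤ p.K →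
      EOfRecord₁₃ F 2 θ.toStage13Params p = Real.log (partitionFn (G := SU 2) (F.P p.K) (p.g0⁻¹ ^ 2)))
    (h1 : B16.Thm1Printed (datumOfRecord₁₃SepCoPH F 2 θ h).C) (em ep : ℝ → ℝ)
    (hae : ∀ p : B12.RunParams, ((datumOfRecord₁₃SepCoPH F 2 θ h).C p).flow.InInterval γ p.K → ∀ k : ℕ, k + 1 ≤ p.K →
      ∀ᵐ V ∂fieldMeasure (F.P p.K) (k + 1) (SU 2),
        B16.UVIneq ((datumOfRecord₁₃SepCoPH F 2 θ h).C p) (k + 1) V (em (((datumOfRecord₁₃SepCoPH F 2 θ h).C p).flow.g (k + 1)))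
          (ep (((datumOfRecord₁₃SepCoPH F 2 θ h).C p).flow.g (k + 1)))) :
    ∃ v : Revision₁₃ F 2 θ h, B16.EndStatementBPrinted (datumOfRecord₁₃SepCoPHV F 2 θ h v).C := by
  let em₀ : ℝ → ℝ := fun g => 0 + 12 * (1 / g) ^ 2
  let ep₀ : ℝ → ℝ := fun g => 4 * (((dimSU 2 : ℕ) : ℝ) * Real.log g⁻¹ + (((2 * 2 : ℕ) : ℝ) * Real.log (16 * Real.pi + 1) + Real.log ((2 * 2 + 1) / (4 * Real.pi)))) + 128
  let em' : ℝ → ℝ := fun g => max (em g) (em₀ g)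
  let ep' : ℝ → ℝ := fun g => max (ep g) (ep₀ g)
  refine exists_revision₁₃_endStatementBPrinted_of_ae θ h hγ em' ep' h1 ?_ ?_
  · intro p hp V
    have h0 := uvIneq_zero_datumOfRecord₁₃CoPH_of_gibbs θ h.toCore p hγ1 hp (hE p hp) V
    have h0' : B16.UVIneq ((datumOfRecord₁₃SepCoPH F 2 θ h).C p) 0 V (em₀ (((datumOfRecord₁₃SepCoPH F 2 θ h).C p).flow.g 0))
        (ep₀ (((datumOfRecord₁₃SepCoPH F 2 θ h).C p).flow.g 0)) := h0
    exact uvIneq_mono_upper (uvIneq_mono_lower (chi_datumOfRecord₁₃SepCoPH_nonneg θ h p 0 V) h0' (le_max_right _ _)) (le_max_right _ _)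
  · intro p hp k hk
    filter_upwards [hae p hp k hk] with V hV
    exact uvIneq_mono_upper (uvIneq_mono_lower (chi_datumOfRecord₁₃SepCoPH_nonneg θ h p (k + 1) V) hV (le_max_left _ _)) (le_max_left _ _)

/-- ★★★ **THE DECIDING CRUX BY NAME FROM THE GIBBS ROAD.**  K1⁹ `…Theses.BalabanUVNodes.StabilityBRunRowsAtRecordR13SepCoPHV` (stmt-QuantumFields-27364) follows from: at ONE witness
`(θ, h)` per family with an admissible unity tuple — (unity ∧ slots), admissibility, [II] Theorem 1's clause at the record, SOME window `γ > 0` on whose runs (with `K ≥ 1`) the witness is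
GIBBS-NORMALISED (`E(P) = log Z_{T^{(0)}}(g₀⁻²)` — a legal OPEN-LETTER choice in DEF-1's Z family, this seat's p645546 §3), exponents `em ep` with [III] Cor. 3 (2.50) `dV_{k+1}`-a.e. at
levels `k+1 ≤ K` of every γ-windowed run (THE open analytic entry), and the rows `RunRowsCont13 F θ` the crux asks (used here ONLY for the window conjunct, NOT for level 0).  No
normalisation item, no coupling floor.  CONDITIONAL; K1⁹ NOT closed. [cite: Balaban1989LargeFieldII, Thm 1 + (0.1) pp.355–356; Balaban1988Convergent, Cor. 3 (2.50) p.264; Balaban1987RG1, Thm 3 p.264] -/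
theorem stabilityBRunRowsAtRecordR13SepCoPHV_of_aeSuccRoad_rows_of_gibbs
    (hroad : ∀ F : T4Family, Inhabited13 F → ∃ (θ : Stage13HParams F 2) (h : θ.Provisos₁₃SepCoPH F 2),
      (θ.ZhUnity F 2 ∧ θ.SlotsNondegenerate₁₃ F 2) ∧ θ.Admissible F 2 ∧
      B16.Thm1Printed (datumOfRecord₁₃SepCoPH F 2 θ h).C ∧
      (∃ γ : ℝ, 0 < γ ∧
        (∀ p : B12.RunParams, ((datumOfRecord₁₃SepCoPH F 2 θ h).C p).flow.InInterval γ p.K → 1 ≤ p.K →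
          EOfRecord₁₃ F 2 θ.toStage13Params p = Real.log (partitionFn (G := SU 2) (F.P p.K) (p.g0⁻¹ ^ 2))) ∧
        ∃ em ep : ℝ → ℝ,
          ∀ p : B12.RunParams, ((datumOfRecord₁₃SepCoPH F 2 θ h).C p).flow.InInterval γ p.K → ∀ k : ℕ, k + 1 ≤ p.K →
            ∀ᵐ V ∂fieldMeasure (F.P p.K) (k + 1) (SU 2),
              B16.UVIneq ((datumOfRecord₁₃SepCoPH F 2 θ h).C p) (k + 1) V (em (((datumOfRecord₁₃SepCoPH F 2 θ h).C p).flow.g (k + 1)))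
                (ep (((datumOfRecord₁₃SepCoPH F 2 θ h).C p).flow.g (k + 1)))) ∧
      RunRowsCont13 F θ) :
    StabilityBRunRowsAtRecordR13SepCoPHV := by
  refine stabilityBRunRowsAtRecordR13SepCoPHV_of_windowFree fun F hinh => ?_
  obtain ⟨θ, h, hU, hθ, h1, ⟨γ, hγ, hE, em, ep, hae⟩, hrows⟩ := hroad F hinh
  have hγ' : 0 < min γ 1 := lt_min hγ one_pos
  have hsub : ∀ p : B12.RunParams, ((datumOfRecord₁₃SepCoPH F 2 θ h).C p).flow.InInterval (min γ 1) p.K →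
      ((datumOfRecord₁₃SepCoPH F 2 θ h).C p).flow.InInterval γ p.K :=
    fun p hp i hi => ⟨(hp i hi).1, (hp i hi).2.trans (min_le_left _ _)⟩
  obtain ⟨v, hB⟩ := exists_revision₁₃_endStatementBPrinted_of_aeSucc_of_gibbs θ h hγ' (min_le_right _ _)
    (fun p hp hK => hE p (hsub p hp) hK) h1 em ep (fun p hp k hk => hae p (hsub p hp) k hk)
  exact ⟨θ, h, v, hU, hθ, hB, hrows⟩

end Summit.QuantumFields.YangMills.BalabanUVNodes.K1R9SlotOfAESuccGibbsAtRecord
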